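import Literature.MathematicalPhysics.QuantumFieldTheory.BorinskyMunchTellander2023.SecondSymanzikIRFace
import Literature.MathematicalPhysics.QuantumFieldTheory.Borinsky2020.TruncationMul
import HarnessLib

/-!
# The initial forms of the PRODUCTS `𝒰^a · ℱ(𝒫)^b` on the faces `−1_γ`: `(Ψ_γ Ψ_{G/γ})^a (Ψ_γ ℱ_{G/γ}(𝒫))^b` (UV) and `(Ψ_γ Ψ_{G/γ})^a (ℱ_γ(𝒫) Ψ_{G/γ})^b` (IR, `γ` m.m.), face values `−(a+b) L_γ` and `−(a+b) L_γ − b` — Borinsky 2020's face bookkeeping for parametric integrands, Gram-matrix kinematics in every regime — PROVED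

**Sources.** M. Borinsky, arXiv:2008.12310 [cite: Borinsky2020] — Definition 1 (truncation `p_F`), Theorem 8 / eq. (atrbtr_exp)
(tropical.tex l.317–318, l.664: the integrand `Π_i a_i^{ν_i} / Π_j b_j^{ρ_j}` and the weighted Minkowski sums `𝒜 = Σ_i (Re ν_i)
NP_{a_i}`, `ℬ = Σ_j (Re ρ_j) NP_{b_j}`, "Π_i a_i^tr(x)^{Re ν_i} / Π_j b_j^tr(x)^{Re ρ_j} = exp(Σ_i Re ν_i max_{v∈NP_{a_i}} ⟨y,v⟩ −
…)"), Lemma (gpMinkowski) (l.1036–1041: "z_{12}(A) = z_1(A) + z_2(A)"), and the proof of Theorem 32 (l.1217: "The form of the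
boolean functions z_Ψ and z_Φ follows directly from the factorization laws"). F. Brown, arXiv:1512.06409 [cite: Brown2017] —
Prop. 2.2, Prop. 2.4, Thm 2.7. K. Schultka, arXiv:1806.01086 [cite: Schultka2018] — Corollary 4.12. M. Borinsky, H. J. Munch,
F. Tellander, arXiv:2302.08955 [cite: BorinskyMunchTellander2023] — §2.1 eq. (polyUF) (`𝒰`, `ℱ` from `𝒫`), Theorems 3.5 / 3.6.

**What is typed (all PROVED; 0 named facts; 0 definitions).** With `Borinsky2020/TruncationMul.lean` (`trunc_mul`, `trunc_pow`,
`faceValue_mul`, `faceValue_pow`) and the factor faces of the companions — `KirchhoffFactorization` / `SecondSymanzikFactorization`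
(`𝒰|_{F_{−1_γ}} = Ψ_γ Ψ_{G/γ}`, every `γ`), `SecondSymanzikUVFace` (`ℱ(𝒫)|_{F_{−1_γ}} = Ψ_γ ℱ_{G/γ}(𝒫)` when `ℱ_{G/γ}(𝒫) ≠ 0`),
`SecondSymanzikIRFace` (`ℱ(𝒫)|_{F_{−1_γ}} = ℱ_γ(𝒫) Ψ_{G/γ}` for `γ` m.m. when `ℱ_γ(𝒫) ≠ 0`) —, for a connected edge list, ANY
symmetric `𝒫` with vanishing row sums and real masses: **`trunc_kirchhoff_pow_mul_gramSecondSymanzik_pow_neg_setIndicator`** (UV: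
`(𝒰^a ℱ(𝒫)^b)|_{F_{−1_γ}} = (Ψ_γ Ψ_{G/γ})^a (Ψ_γ ℱ_{G/γ}(𝒫))^b`) with **`faceValue_kirchhoff_pow_mul_gramSecondSymanzik_pow_neg_setIndicator`**
(`= −(a + b) L_γ`), and the IR pair **`…_of_mm`** (`(Ψ_γ Ψ_{G/γ})^a (ℱ_γ(𝒫) Ψ_{G/γ})^b`, face value `−((a + b) L_γ + b)`); the
`a = b = 1` forms `trunc_kirchhoff_mul_gramSecondSymanzik_neg_setIndicator(_of_mm)`. These are the initial forms, on every UV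
face and on every IR face of an m.m. `γ`, of the polynomial part of the parametric integrands the tropical sampler decomposes
(Borinsky's `z_{12} = z_1 + z_2` bookkeeping, read for `z_𝒰 = L`, `z_ℱ = L + [m.m.]`), for the Minkowski `ℱ` of Gram-matrix
kinematics. NOT typed: non-integer powers (Borinsky's `Re ν_i`; the tree's `trunc` is polynomial), the sum `𝒰 + ℱ`
(Lee–Pomeransky; truncations are not additive), sector integrals, anything operator-level. D-0026: 0 facts.
-/

noncomputable section

namespace Literature.MathematicalPhysics.QuantumFieldTheory.BorinskyMunchTellander2023

open Finset MvPolynomial Matrix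
open Literature.MathematicalPhysics.QuantumFieldTheory
open Literature.MathematicalPhysics.QuantumFieldTheory.Borinsky2020

variable {N V : ℕ} {E : Fin N → Fin (V + 1) × Fin (V + 1)} {P : Matrix (Fin (V + 1)) (Fin (V + 1)) ℝ}

/-! ## UV faces: every `γ` with `ℱ_{G/γ}(𝒫) ≠ 0` -/

/-- **`(𝒰 · ℱ(𝒫))|_{F_{−1_γ}} = (Ψ_γ Ψ_{G/γ}) · (Ψ_γ ℱ_{G/γ}(𝒫))`** whenever `ℱ_{G/γ}(𝒫) ≠ 0` (every symmetric conserved `𝒫`).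
[cite: Borinsky2020, Definition 1, eq. (atrbtr_exp) (tropical.tex l.664) and Theorem 32 (proof, l.1217); Brown2017, Prop. 2.2 / Thm 2.7; Schultka2018, Corollary 4.12] -/
theorem trunc_kirchhoff_mul_gramSecondSymanzik_neg_setIndicator (hconn : IsConnectedEdgeList E) (hP : P.IsSymm)
    (hcons : ∀ u, ∑ v, P u v = 0) (m : Fin N → ℝ) {γ : Finset (Fin N)} (hq : gramSecondSymanzikQuot E γ P m ≠ 0) :
    trunc (kirchhoffPolynomial ℝ E * gramSecondSymanzik E P m) (-setIndicator γ) =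
      (kirchhoffSub E γ * kirchhoffQuot E γ) * (kirchhoffSub E γ * gramSecondSymanzikQuot E γ P m) := by
  rw [trunc_mul, trunc_kirchhoffPolynomial_eq_kirchhoffSub_mul_kirchhoffQuot E hconn γ,
    (faceValue_and_trunc_gramSecondSymanzik_neg_setIndicator hconn hP hcons m hq).2]

/-- `ℱ(𝒫) ≠ 0` as soon as some `ℱ_{G/γ}(𝒫) ≠ 0` (its truncation to `F_{−1_γ}` is the non-zero `Ψ_γ ℱ_{G/γ}(𝒫)`).
[cite: BorinskyMunchTellander2023, §3.3 and Theorem 3.5; Brown2017, Thm 2.7] -/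
theorem gramSecondSymanzik_ne_zero_of_quot_ne_zero (hconn : IsConnectedEdgeList E) (hP : P.IsSymm)
    (hcons : ∀ u, ∑ v, P u v = 0) (m : Fin N → ℝ) {γ : Finset (Fin N)} (hq : gramSecondSymanzikQuot E γ P m ≠ 0) :
    gramSecondSymanzik E P m ≠ 0 := by
  intro h0
  have h := (faceValue_and_trunc_gramSecondSymanzik_neg_setIndicator hconn hP hcons m hq).2
  rw [h0, trunc_zero] at h
  exact mul_ne_zero (kirchhoffSub_ne_zero E γ) hq h.symm

/-- **`(𝒰^a · ℱ(𝒫)^b)|_{F_{−1_γ}} = (Ψ_γ Ψ_{G/γ})^a · (Ψ_γ ℱ_{G/γ}(𝒫))^b`** whenever `ℱ_{G/γ}(𝒫) ≠ 0` — the initial form of the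
polynomial part of a parametric integrand on a UV face (Borinsky's products `Π a_i^{ν_i}`, integer exponents).
[cite: Borinsky2020, Theorem 8 / eq. (atrbtr_exp) (tropical.tex l.317–318, l.664), Definition 1, Theorem 32 (proof, l.1217); Brown2017, Prop. 2.2 / Thm 2.7] -/
theorem trunc_kirchhoff_pow_mul_gramSecondSymanzik_pow_neg_setIndicator (hconn : IsConnectedEdgeList E) (hP : P.IsSymm)
    (hcons : ∀ u, ∑ v, P u v = 0) (m : Fin N → ℝ) {γ : Finset (Fin N)} (hq : gramSecondSymanzikQuot E γ P m ≠ 0) (a b : ℕ) :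
    trunc (kirchhoffPolynomial ℝ E ^ a * gramSecondSymanzik E P m ^ b) (-setIndicator γ) =
      (kirchhoffSub E γ * kirchhoffQuot E γ) ^ a * (kirchhoffSub E γ * gramSecondSymanzikQuot E γ P m) ^ b := by
  rw [trunc_mul, trunc_pow, trunc_pow, trunc_kirchhoffPolynomial_eq_kirchhoffSub_mul_kirchhoffQuot E hconn γ,
    (faceValue_and_trunc_gramSecondSymanzik_neg_setIndicator hconn hP hcons m hq).2]

/-- **The face value of `NP(𝒰^a ℱ(𝒫)^b)` in direction `−1_γ` is `−(a + b) L_γ`** whenever `ℱ_{G/γ}(𝒫) ≠ 0` — Borinsky's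
`z_{12}(γ) = z_1(γ) + z_2(γ)` with `z_𝒰(γ) = L_γ` and `z_ℱ(γ) = L_γ` (the non-m.m. branch).
[cite: Borinsky2020, Lemma (gpMinkowski) (tropical.tex l.1036–1041), eq. (atrbtr_exp) (l.664), Theorem 32; BorinskyMunchTellander2023, Theorems 3.5 / 3.6] -/
theorem faceValue_kirchhoff_pow_mul_gramSecondSymanzik_pow_neg_setIndicator (hconn : IsConnectedEdgeList E) (hP : P.IsSymm)
    (hcons : ∀ u, ∑ v, P u v = 0) (m : Fin N → ℝ) {γ : Finset (Fin N)} (hq : gramSecondSymanzikQuot E γ P m ≠ 0) (a b : ℕ) :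
    faceValue (kirchhoffPolynomial ℝ E ^ a * gramSecondSymanzik E P m ^ b) (-setIndicator γ) =
      -(((a + b) * loopNumber E γ : ℕ) : ℝ) := by
  have hΨ : kirchhoffPolynomial ℝ E ≠ 0 := kirchhoffPolynomial_ne_zero E ℝ hconn
  have hℱ : gramSecondSymanzik E P m ≠ 0 := gramSecondSymanzik_ne_zero_of_quot_ne_zero hconn hP hcons m hq
  rw [faceValue_mul (pow_ne_zero a hΨ) (pow_ne_zero b hℱ), faceValue_pow hΨ, faceValue_pow hℱ,
    faceValue_kirchhoffPolynomial_neg_setIndicator E hconn γ,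
    (faceValue_and_trunc_gramSecondSymanzik_neg_setIndicator hconn hP hcons m hq).1]
  push_cast
  ring

/-! ## IR faces: `γ` mass-momentum spanning with `ℱ_γ(𝒫) ≠ 0` -/

/-- **`(𝒰 · ℱ(𝒫))|_{F_{−1_γ}} = (Ψ_γ Ψ_{G/γ}) · (ℱ_γ(𝒫) Ψ_{G/γ})`** for `γ` mass-momentum spanning, `a` reaching the external
vertices inside `γ`, whenever `ℱ_γ(𝒫) ≠ 0`. [cite: Borinsky2020, Definition 1, eq. (atrbtr_exp) (tropical.tex l.664) and Theorem 32 (proof, l.1217); Brown2017, Prop. 2.2 / Prop. 2.4 / Thm 2.7; Schultka2018, Corollary 4.12] -/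
theorem trunc_kirchhoff_mul_gramSecondSymanzik_neg_setIndicator_of_mm (hconn : IsConnectedEdgeList E) (hP : P.IsSymm)
    (hcons : ∀ u, ∑ v, P u v = 0) {m : Fin N → ℝ} {γ : Finset (Fin N)} (hmm : IsMassMomentumSpanningGram E P m γ)
    {a : Fin (V + 1)} (ha : ∀ v, IsExternal P v → (edgeGraph E γ).Reachable a v) (hsub : gramSecondSymanzikSub E γ P m a ≠ 0) :
    trunc (kirchhoffPolynomial ℝ E * gramSecondSymanzik E P m) (-setIndicator γ) =
      (kirchhoffSub E γ * kirchhoffQuot E γ) * (gramSecondSymanzikSub E γ P m a * kirchhoffQuot E γ) := by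
  rw [trunc_mul, trunc_kirchhoffPolynomial_eq_kirchhoffSub_mul_kirchhoffQuot E hconn γ,
    (faceValue_and_trunc_gramSecondSymanzik_neg_setIndicator_of_mm hconn hP hcons hmm ha hsub).2]

/-- `ℱ(𝒫) ≠ 0` as soon as some `ℱ_γ(𝒫) ≠ 0` for an m.m. `γ`. [cite: Brown2017, Thm 2.7; BorinskyMunchTellander2023, Theorem 3.5] -/
theorem gramSecondSymanzik_ne_zero_of_sub_ne_zero (hconn : IsConnectedEdgeList E) (hP : P.IsSymm)
    (hcons : ∀ u, ∑ v, P u v = 0) {m : Fin N → ℝ} {γ : Finset (Fin N)} (hmm : IsMassMomentumSpanningGram E P m γ)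
    {a : Fin (V + 1)} (ha : ∀ v, IsExternal P v → (edgeGraph E γ).Reachable a v) (hsub : gramSecondSymanzikSub E γ P m a ≠ 0) :
    gramSecondSymanzik E P m ≠ 0 := by
  intro h0
  have h := (faceValue_and_trunc_gramSecondSymanzik_neg_setIndicator_of_mm hconn hP hcons hmm ha hsub).2
  rw [h0, trunc_zero] at h
  exact mul_ne_zero hsub (kirchhoffQuot_ne_zero E γ) h.symm

/-- **`(𝒰^a · ℱ(𝒫)^b)|_{F_{−1_γ}} = (Ψ_γ Ψ_{G/γ})^a · (ℱ_γ(𝒫) Ψ_{G/γ})^b`** on the IR face of an m.m. `γ` with `ℱ_γ(𝒫) ≠ 0`.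
[cite: Borinsky2020, Theorem 8 / eq. (atrbtr_exp) (tropical.tex l.317–318, l.664), Definition 1, Theorem 32 (proof, l.1217); Brown2017, Prop. 2.2 / Prop. 2.4 / Thm 2.7] -/
theorem trunc_kirchhoff_pow_mul_gramSecondSymanzik_pow_neg_setIndicator_of_mm (hconn : IsConnectedEdgeList E) (hP : P.IsSymm)
    (hcons : ∀ u, ∑ v, P u v = 0) {m : Fin N → ℝ} {γ : Finset (Fin N)} (hmm : IsMassMomentumSpanningGram E P m γ)
    {a : Fin (V + 1)} (ha : ∀ v, IsExternal P v → (edgeGraph E γ).Reachable a v) (hsub : gramSecondSymanzikSub E γ P m a ≠ 0)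
    (na nb : ℕ) :
    trunc (kirchhoffPolynomial ℝ E ^ na * gramSecondSymanzik E P m ^ nb) (-setIndicator γ) =
      (kirchhoffSub E γ * kirchhoffQuot E γ) ^ na * (gramSecondSymanzikSub E γ P m a * kirchhoffQuot E γ) ^ nb := by
  rw [trunc_mul, trunc_pow, trunc_pow, trunc_kirchhoffPolynomial_eq_kirchhoffSub_mul_kirchhoffQuot E hconn γ,
    (faceValue_and_trunc_gramSecondSymanzik_neg_setIndicator_of_mm hconn hP hcons hmm ha hsub).2]

/-- **The face value of `NP(𝒰^a ℱ(𝒫)^b)` in direction `−1_γ`, `γ` m.m. with `ℱ_γ(𝒫) ≠ 0`, is `−((a + b) L_γ + b)`** — Borinsky's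
`z_{12} = z_1 + z_2` with `z_𝒰(γ) = L_γ`, `z_ℱ(γ) = L_γ + 1` (the m.m. branch of Theorem 32 / BMT23 Theorem 3.5).
[cite: Borinsky2020, Lemma (gpMinkowski) (tropical.tex l.1036–1041), eq. (atrbtr_exp) (l.664), Theorem 32; BorinskyMunchTellander2023, Theorem 3.5] -/
theorem faceValue_kirchhoff_pow_mul_gramSecondSymanzik_pow_neg_setIndicator_of_mm (hconn : IsConnectedEdgeList E)
    (hP : P.IsSymm) (hcons : ∀ u, ∑ v, P u v = 0) {m : Fin N → ℝ} {γ : Finset (Fin N)}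
    (hmm : IsMassMomentumSpanningGram E P m γ) {a : Fin (V + 1)} (ha : ∀ v, IsExternal P v → (edgeGraph E γ).Reachable a v)
    (hsub : gramSecondSymanzikSub E γ P m a ≠ 0) (na nb : ℕ) :
    faceValue (kirchhoffPolynomial ℝ E ^ na * gramSecondSymanzik E P m ^ nb) (-setIndicator γ) =
      -(((na + nb) * loopNumber E γ + nb : ℕ) : ℝ) := by
  have hΨ : kirchhoffPolynomial ℝ E ≠ 0 := kirchhoffPolynomial_ne_zero E ℝ hconn
  have hℱ : gramSecondSymanzik E P m ≠ 0 := gramSecondSymanzik_ne_zero_of_sub_ne_zero hconn hP hcons hmm ha hsub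
  rw [faceValue_mul (pow_ne_zero na hΨ) (pow_ne_zero nb hℱ), faceValue_pow hΨ, faceValue_pow hℱ,
    faceValue_kirchhoffPolynomial_neg_setIndicator E hconn γ,
    (faceValue_and_trunc_gramSecondSymanzik_neg_setIndicator_of_mm hconn hP hcons hmm ha hsub).1]
  push_cast
  ring

end Literature.MathematicalPhysics.QuantumFieldTheory.BorinskyMunchTellander2023
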